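import Summits.CriticalPhenomena.CardyFormulaZ2.Theorems.CardyFlipRussoQuadrupoleSelectionRuleCocircSimilarity
import Summits.CriticalPhenomena.CardyFormulaZ2.Theorems.CardyFlipRussoQuadrupoleSelectionRuleSpinTwo

/-!
# The Delaunay flip kernel is spin 2 (card C, second lemma)

Helper file for the crux `QuadrupoleSelectionRule` (stmt-CriticalPhenomena-7029, informal) of route
`CardyFlipRusso` (sub-problem `CardyFormulaZ2`), line `Sketch`: the card statement
`CocircStrainSpinTwo` of idea card `poisson-hub-ward-identity`, obtained by applying the landed
stub S7 (`spinTwo_of_similarity`: any similarity-covariant function of four points responds to a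
strain of the rotated quadrilateral as to the spin-2-rotated strain of the original one) to the
cocircularity determinant, which is similarity covariant by the landed stub S6
(`cocirc_det_similarity`).

The first-order response of the Delaunay condition of a quadrilateral `Q` to a strain with
Beltrami coefficient `b` is therefore `Re (b̄ · q(Q))` with `q(e^{iθ} Q) = e^{2iθ} q(Q)`: the flip
rate is a QUADRUPOLE, the local object behind the selection rule.
-/

noncomputable section

namespace Summit.CriticalPhenomena.CardyFormulaZ2.Theorems

/-- **Card C, second lemma (`CocircStrainSpinTwo`): the flip kernel is spin 2.** For the Delaunay
cocircularity determinant (rows `(Re zᵢ, Im zᵢ, |zᵢ|², 1)`), straining the rotated quadrilateral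
`e^{iθ} z` by the Beltrami coefficient `b` (`w ↦ w + s b w̄`) gives the same value as straining `z`
by `b e^{-2iθ}`. [folklore] -/
theorem cocirc_det_strain_spinTwo (z : Fin 4 → ℂ) (b : ℂ) (θ s : ℝ) :
    Matrix.det (Matrix.of fun i j =>
        (![(Complex.exp ((θ : ℂ) * Complex.I) * z i
              + (s : ℂ) * b * (starRingEnd ℂ) (Complex.exp ((θ : ℂ) * Complex.I) * z i)).re,
           (Complex.exp ((θ : ℂ) * Complex.I) * z i
              + (s : ℂ) * b * (starRingEnd ℂ) (Complex.exp ((θ : ℂ) * Complex.I) * z i)).im,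
           Complex.normSq (Complex.exp ((θ : ℂ) * Complex.I) * z i
              + (s : ℂ) * b * (starRingEnd ℂ) (Complex.exp ((θ : ℂ) * Complex.I) * z i)),
           1] : Fin 4 → ℝ) j)
      = Matrix.det (Matrix.of fun i j =>
        (![(z i + (s : ℂ) * (b * Complex.exp (-(2 * (θ : ℂ)) * Complex.I)) * (starRingEnd ℂ) (z i)).re,
           (z i + (s : ℂ) * (b * Complex.exp (-(2 * (θ : ℂ)) * Complex.I)) * (starRingEnd ℂ) (z i)).im,
           Complex.normSq
             (z i + (s : ℂ) * (b * Complex.exp (-(2 * (θ : ℂ)) * Complex.I)) * (starRingEnd ℂ) (z i)),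
           1] : Fin 4 → ℝ) j) :=
  spinTwo_of_similarity
    (fun w : Fin 4 → ℂ => Matrix.det (Matrix.of fun i j =>
      (![(w i).re, (w i).im, Complex.normSq (w i), 1] : Fin 4 → ℝ) j))
    cocirc_det_similarity z b θ s

/-- **Similarities flip no Delaunay quadrilateral.** Under `w ↦ a w + c` with `a ≠ 0` the
cocircularity determinant keeps its sign: the Delaunay diagonal of every quadrilateral is
unchanged by translations, rotations and dilations (so, to first order, a smooth deformation acts
on the triangulation only through its strain). [folklore] -/
theorem cocirc_det_similarity_pos_iff (z : Fin 4 → ℂ) {a : ℂ} (ha : a ≠ 0) (c : ℂ) :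
    0 < Matrix.det (Matrix.of fun i j =>
        (![(a * z i + c).re, (a * z i + c).im, Complex.normSq (a * z i + c), 1] : Fin 4 → ℝ) j)
      ↔ 0 < Matrix.det (Matrix.of fun i j =>
        (![(z i).re, (z i).im, Complex.normSq (z i), 1] : Fin 4 → ℝ) j) := by
  rw [cocirc_det_similarity]
  have h : 0 < Complex.normSq a ^ 2 := pow_pos (Complex.normSq_pos.2 ha) 2
  exact mul_pos_iff_of_pos_left h

/-- Degenerate (cocircular or collinear) quadrilaterals are likewise preserved by similarities.
[folklore] -/
theorem cocirc_det_similarity_eq_zero_iff (z : Fin 4 → ℂ) {a : ℂ} (ha : a ≠ 0) (c : ℂ) :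
    Matrix.det (Matrix.of fun i j =>
        (![(a * z i + c).re, (a * z i + c).im, Complex.normSq (a * z i + c), 1] : Fin 4 → ℝ) j) = 0
      ↔ Matrix.det (Matrix.of fun i j =>
        (![(z i).re, (z i).im, Complex.normSq (z i), 1] : Fin 4 → ℝ) j) = 0 := by
  rw [cocirc_det_similarity, mul_eq_zero, or_iff_right]
  exact pow_ne_zero 2 (Complex.normSq_pos.2 ha).ne'

end Summit.CriticalPhenomena.CardyFormulaZ2.Theorems

end
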